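import Summits.QuantumFields.YangMills.Theses.RandomisedStokes
import HarnessLib

/-!
# Route `RandomisedStokes` (planner ym-r3-idea-2 g8, LINE 18 «randomised Stokes»; crux stmt-QuantumFields-19936 `UnitScaleTilt.HistoryTailL`) —
# registered stub `stub_crux_of_package : ChaosPackageL → ChaosSuppressedDominationL`, BY NAME AND SIGNATURE

The skeleton `Cruxes/HistoryTailL/Lines/randomised_stokes.lean` (registered on 19936, sha a28d4d1b92bf) cuts the deciding crux
`ChaosSuppressedDominationL` (stmt-QuantumFields-23885, XL) into the CHAOS PACKAGE `ChaosPackageL` (a deterministic functional `N_q` with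
(i) the two-term domination `dist1(Ū^j(∂q)) ≤ D₀(j+1)η + |N_q U|` under profile flatness and (ii) the chaos tail
`Gibbs_K(flat ∧ η < |N_q U|) ≤ Cβ^A exp(−(cη/g_h²)^α)`) and the bookkeeping stub `stub_crux_of_package` («S/M: D = D₀ + 1 and monotonicity of
Measure.real»).  This file proves that stub: with `D := D₀ + 1`, on the event `flat ∧ D(j+1)η < dist1(Ū^j(∂q))` clause (i) gives
`(j+1)η < |N_q U|`, hence `η < |N_q U|` (`j + 1 ≥ 1`), so the event lies in the chaos-tail event of (ii) and `measureReal_mono` (the Gibbs law is a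
probability measure) finishes.  The Props `ChaosPackageL` / `ChaosSuppressedDominationL` are reproduced VERBATIM from the skeleton (the latter is
also byte-identical to the route decl `Summit.QuantumFields.YangMills.Theses.RandomisedStokes.ChaosSuppressedDominationL`, see
`chaosSuppressedDominationL_iff`), so the skeleton's stub is discharged by definitional unfolding, and `chaosSuppressedDominationL_of_package`
states the implication with the route decl BY NAME.

Width seat ym-line-sfw-p2-w3 g32 (cell ym-idea-1, R3 family; free hands).  HONEST FRAMING: the package `ChaosPackageL` (the line's XL content),
`RectangleTailL`, `ThinDeepWindowTailL`, the glue and the crux 19936 are OPEN; no crux, rung or summit is proved; `YM3TorusSU2` and the Yang–Mills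
mass gap are NOT proved.  R3 is a RECORD rung.
-/

set_option autoImplicit false

namespace Summit.QuantumFields.YangMills.Theorems.RandomisedStokes

open scoped BigOperators Topology Classical MeasureTheory ProbabilityTheory Matrix
open MeasureTheory

/-- = the skeleton's / the route's `ChaosSuppressedDominationL` (stmt-QuantumFields-23885; byte-identical body): chaos-suppressed domination
of the `j`-fold averaged plaquette by finest rectangles, `Gibbs_K(profile-flat ∧ D(j+1)η < dist1(Ū^j(∂q))) ≤ Cβ^A exp(−(cη/g_h²)^α)`. -/
def ChaosSuppressedDominationL : Prop :=
  open Literature.MathematicalPhysics.QuantumFieldTheory.Balaban1983to89 Literature.MathematicalPhysics.QuantumFieldTheory.Balaban1983to89.T3ContinuumYM3Torus in ∀ (L : ℕ), ∃ (D R α c C : ℝ) (A : ℕ), 1 ≤ D ∧ 2 ≤ R ∧ 0 < α ∧ 0 < c ∧ 0 ≤ C ∧ ∀ (F : T3Family) (γ : ℝ), F.L = L → 0 < γ → γ ≤ 1 → ∀ (K j : ℕ) (q : Plaq (F.P K) j) (η : ℝ), j ≤ K → 0 < η → η ≤ 1 → (T3UnitScaleTilt.gibbsK F T3UnitLawDensityEML.ℰp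 γ K).real {U | (∀ (i a b : ℕ) (x : Site (F.P K) 0) (μ ν : Fin (F.P K).d), μ ≠ ν → i ≤ j → 1 ≤ a → 1 ≤ b → 2 * (a + b) < (F.P K).sitesPerDir 0 → ((a : ℝ) + b) ≤ R * (L : ℝ) ^ i → GaugeGroup.dist1 (Missing.pathHol U (Missing.rectLoop x μ ν a b)) ≤ η * Real.sqrt ((L : ℝ) ^ i / (L : ℝ) ^ j)) ∧ D * ((j : ℝ) + 1) * η < GaugeGroup.dist1 (GaugeField.plaqHol (Averaging.iter (fun i => BlockAveraging.blockAvg (P := F.P K) (j := i) T3UnitLawDensityEML.ℰp) j U) q)} ≤ C * (F.scheme T3UnitLawDensityEML.ℰp γ).β K ^ A * Real.exp (-((c * (η / (γ * ((L : ℝ)⁻¹) ^ (K - j)))) ^ α))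

/-- = the skeleton's `ChaosPackageL` (byte-identical body): a deterministic functional `N_q` with (i) two-term domination under profile
flatness and (ii) the chaos tail. -/
def ChaosPackageL : Prop :=
  open Literature.MathematicalPhysics.QuantumFieldTheory.Balaban1983to89 Literature.MathematicalPhysics.QuantumFieldTheory.Balaban1983to89.T3ContinuumYM3Torus in ∀ (L : ℕ), ∃ (D₀ R α c C : ℝ) (A : ℕ), 0 ≤ D₀ ∧ 2 ≤ R ∧ 0 < α ∧ 0 < c ∧ 0 ≤ C ∧ ∀ (F : T3Family) (γ : ℝ), F.L = L → 0 < γ → γ ≤ 1 → ∀ (K j : ℕ) (q : Plaq (F.P K) j), j ≤ K → ∃ N : GaugeField (F.P K) 0 (Matrix.specialUnitaryGroup (Fin 2) ℂ) → ℝ, (∀ (U : GaugeField (F.P K) 0 (Matrix.specialUnitaryGroup (Fin 2) ℂ)) (η : ℝ), 0 < η → (∀ (i a b : ℕ) (x : Site (F.P K) 0) (μ ν : Fin (F.P K).d), μ ≠ ν → i ≤ j → 1 ≤ a → 1 ≤ b → 2 * (a + b) < (F.P K).sitesPerDir 0 → ((a : ℝ) + b) ≤ R * (L : ℝ) ^ i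 → GaugeGroup.dist1 (Missing.pathHol U (Missing.rectLoop x μ ν a b)) ≤ η * Real.sqrt ((L : ℝ) ^ i / (L : ℝ) ^ j)) → GaugeGroup.dist1 (GaugeField.plaqHol (Averaging.iter (fun i => BlockAveraging.blockAvg (P := F.P K) (j := i) T3UnitLawDensityEML.ℰp) j U) q) ≤ D₀ * ((j : ℝ) + 1) * η + |N U|) ∧ (∀ (η : ℝ), 0 < η → η ≤ 1 → (T3UnitScaleTilt.gibbsK F T3UnitLawDensityEML.ℰp γ K).real {U | (∀ (i a b : ℕ) (x : Site (F.P K) 0) (μ ν : Fin (F.P K).d), μ ≠ ν → i ≤ j → 1 ≤ a → 1 ≤ b → 2 * (a + b) < (F.P K).sitesPerDir 0 → ((a : ℝ) + b) ≤ R * (L : ℝ) ^ i → GaugeGroup.dist1 (Missing.pathHol U (Missing.rectLoop x μ ν a b)) ≤ η * Real.sqrt ((L : ℝ) ^ i / (L : ℝ) ^ j)) ∧ η < |N U|} ≤ C * (F.scheme T3UnitLawDensityEML.ℰp γ).β K ^ A * Real.exp (-((c * (η / (γ * ((L : ℝ)⁻¹) ^ (K - j)))) ^ α)))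

/-- The local copy IS the route decl (definitional). -/
theorem chaosSuppressedDominationL_iff :
    ChaosSuppressedDominationL ↔ Summit.QuantumFields.YangMills.Theses.RandomisedStokes.ChaosSuppressedDominationL := Iff.rfl

/-- Registered stub `stub_crux_of_package` of LINE 18 (header verbatim = the skeleton's): the chaos package implies the crux with
`D := D₀ + 1` — on `{flat ∧ (D₀+1)(j+1)η < dist1}` clause (i) forces `η ≤ (j+1)η < |N_q U|`, so the event lies in the chaos-tail event of
clause (ii); monotonicity of `Measure.real`. [folklore] -/
theorem stub_crux_of_package : ChaosPackageL → ChaosSuppressedDominationL := by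
  intro h L
  obtain ⟨D₀, R, α, c, C, A, hD₀, hR, hα, hc, hC, H⟩ := h L
  refine ⟨D₀ + 1, R, α, c, C, A, by linarith, hR, hα, hc, hC, ?_⟩
  intro F γ hFL hγ hγ1 K j q η hjK hη hη1
  obtain ⟨N, hdom, htail⟩ := H F γ hFL hγ hγ1 K j q hjK
  haveI := Literature.MathematicalPhysics.QuantumFieldTheory.Balaban1983to89.T3UnitScaleTilt.isProbabilityMeasure_gibbsK
    (F := F) (ℰ := Literature.MathematicalPhysics.QuantumFieldTheory.Balaban1983to89.T3UnitLawDensityEML.ℰp) hγ.le K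
  refine le_trans (measureReal_mono ?_ (measure_ne_top _ _)) (htail η hη hη1)
  intro U hU
  simp only [Set.mem_setOf_eq] at hU ⊢
  obtain ⟨hflat, hbig⟩ := hU
  refine ⟨hflat, ?_⟩
  have h1 := hdom U η hη hflat
  have hj : (0 : ℝ) ≤ (j : ℝ) := Nat.cast_nonneg _
  have hjη : η ≤ ((j : ℝ) + 1) * η := by nlinarith
  nlinarith

/-- The same implication with the ROUTE decl as conclusion (BY NAME). [folklore] -/
theorem chaosSuppressedDominationL_of_package (h : ChaosPackageL) :
    Summit.QuantumFields.YangMills.Theses.RandomisedStokes.ChaosSuppressedDominationL :=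
  stub_crux_of_package h

end Summit.QuantumFields.YangMills.Theorems.RandomisedStokes
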